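import Summits.ValiantsHypothesis.ValiantsHypothesis.Theorems.BarrierLeverChowBenchmarkPairsMidpointPoised

/-!
# Route BarrierLever — item 22038 `ChowBenchmarkPairs`, line `moore-peel`: KERNEL POISEDNESS `KernelPoisedAt w h`
# — the segment-mean statement with an arbitrary weight sequence — from THEOREM A^κ

Helper file (`--supports stmt-ValiantsHypothesis-22038`; cell valiant-natproofs, rung V4, 𝒟-side benchmark of
record, line `moore_peel`, card v12 (E)(ii)–(iii); seat val-np-p4 gen 26).  Closes NO item.  Two definitions:
the kernel-weighted segment entry `kerE w P S T = Σ_{g : T → S} ∏_{c∈T} P_{g c,c} · ∏_{a∈S} w(|g⁻¹ a|)` over any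
commutative ring (`w = k!`: the line file's `segEntry` / `segE` of `…ChowBenchmarkPairsPeelRows` VERBATIM;
`w = 1`: the midpoint entry, `kerE_one`; `w = α^{(k)}`: Dirichlet(α,α) segment moments up to a column factor)
and the statement `KernelPoisedAt w h` (= `SegmentMeanValueAt h` of the line file with `k! ↦ w k`).

* `kerE_empty` / `_singleton` / `_pair` (rows of size `≤ 2`; proofs of `segE_singleton` / `segE_pair` with
  `k! ↦ w k`), `map_kerE`, `kerE_one`; `kerE_*_eq_krow`: with symbolic Moore nodes `P_{a,c} = X_a^(2^c)` these
  rows ARE the stage-1 `w`-rows `krow w` (`…KernelPeelRows`); **`kernelPoisedAt_of_kpeel`** — THEOREM A^κ ⇒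
  `(∀ k, w k ≠ 0) → (∀ i ∈ [1,h], det G^w_i ≠ 0) → KernelPoisedAt w h`; `kernelPoisedAt_one_iff` (`↔
  MidpointPoisedAt h`), `kernelPoisedAt_one` (THEOREM M again), `kernelPoisedAt_factorial_of_peel`.

WHAT THIS IS NOT: no stub of line `moore_peel` is closed (`KernelPoisedAt Nat.factorial h` for ALL `h` is the open
stub `stub_segmentMeanValue`; here it is only derived under the peel hypothesis, which fails at `i = 183`);
nothing on crux stmt-ValiantsHypothesis-14610 or on `VP` versus `VNP`.
-/

set_option linter.dupNamespace false

namespace Summit.ValiantsHypothesis.ValiantsHypothesis.Theorems.BarrierLever.MoorePeel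

open Polynomial Finset

/-! ## 8. The kernel-weighted segment entries and `KernelPoisedAt κ h` -/

/-- **The kernel-weighted segment entry** `kerE w P S T = Σ_{g : T → S} ∏_{c∈T} P_{g(c),c} · ∏_{a∈S} w(|g⁻¹(a)|)`
of a point table `P : π → κ' → R` (any commutative ring): `w = Nat.factorial` is the line file's `segEntry`
(`segE` of `…ChowBenchmarkPairsPeelRows`) verbatim, `w = 1` the midpoint entry `∏_{c∈T} Σ_{a∈S} P_{a,c}`
(`kerE_one`), `w = Nat.ascFactorial α` the Dirichlet(α,α) segment moments (up to the column factor
`(2α)^{(|T|)}`). -/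
def kerE {R : Type*} [CommRing R] {π κ' : Type*} [DecidableEq π] [DecidableEq κ'] (w : ℕ → ℕ)
    (P : π → κ' → R) (S : Finset π) (T : Finset κ') : R :=
  ∑ g : (↥T → ↥S), (∏ c : ↥T, P (g c) c) *
    ∏ a : ↥S, ((w (Finset.univ.filter fun c : ↥T => g c = a).card : ℕ) : R)

/-- **Kernel poisedness at height `h`** (the line file's `SegmentMeanValueAt h` with `k! ↦ w k`): some point
table makes the kernel-weighted segment-moment matrix of the benchmark layout nonsingular. -/
def KernelPoisedAt (w : ℕ → ℕ) (h : ℕ) : Prop :=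
  ∀ (r : ℕ) (u : Fin r → Finset (Fin h)), Function.Injective u → (∀ i, (u i).card ≤ 2) →
    (∀ S : Finset (Fin h), S.card ≤ 2 → ∃ i, u i = S) →
    ∃ P : Fin h → Fin h → ℂ, (Matrix.of fun i j : Fin r => kerE w P (u i) (benchCols h r j)).det ≠ 0

section KerE
variable {R : Type*} [CommRing R] {π κ' : Type*} [DecidableEq π] [DecidableEq κ'] (w : ℕ → ℕ)

/-- Ring homomorphisms act on kernel entries entrywise on the table. -/
theorem map_kerE {R' : Type*} [CommRing R'] (f : R →+* R') (P : π → κ' → R) (S : Finset π)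
    (T : Finset κ') : f (kerE w P S T) = kerE w (fun a c => f (P a c)) S T := by
  unfold kerE
  rw [map_sum]
  refine Finset.sum_congr rfl fun g _ => ?_
  rw [map_mul, map_prod, map_prod]
  congr 1
  exact Finset.prod_congr rfl fun a _ => by rw [map_natCast]

/-- Row `∅`: `kerE w P ∅ T = [T = ∅]`. -/
theorem kerE_empty (P : π → κ' → R) (T : Finset κ') :
    kerE w P ∅ T = if T = ∅ then 1 else 0 := by
  classical
  unfold kerE
  by_cases hT : T = ∅
  · subst hT
    rw [if_pos rfl]
    haveI : Unique (↥(∅ : Finset κ') → ↥(∅ : Finset π)) := Pi.uniqueOfIsEmpty _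
    rw [Fintype.sum_unique]
    simp
  · rw [if_neg hT]
    haveI : Nonempty ↥T := by
      obtain ⟨c, hc⟩ := Finset.nonempty_iff_ne_empty.mpr hT
      exact ⟨⟨c, hc⟩⟩
    exact Fintype.sum_empty _

/-- Row `{a}`: `kerE w P {a} T = w|T| · ∏_{c∈T} P a c`. -/
theorem kerE_singleton (P : π → κ' → R) (a : π) (T : Finset κ') :
    kerE w P {a} T = ((w T.card : ℕ) : R) * ∏ c ∈ T, P a c := by
  classical
  unfold kerE
  haveI hU : Unique ↥({a} : Finset π) :=
    ⟨⟨⟨a, Finset.mem_singleton_self a⟩⟩, fun x => Subtype.ext (Finset.mem_singleton.mp x.2)⟩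
  rw [Fintype.sum_unique]
  set g₀ : ↥T → ↥({a} : Finset π) := default with hg₀
  have hg : ∀ c : ↥T, ((g₀ c : ↥({a} : Finset π)) : π) = a := fun c =>
    Finset.mem_singleton.mp (g₀ c).2
  rw [Fintype.prod_unique (fun a' : ↥({a} : Finset π) =>
    ((w (Finset.univ.filter fun c : ↥T => g₀ c = a').card : ℕ) : R))]
  have hfilter : (Finset.univ.filter fun c : ↥T => g₀ c = default) = Finset.univ :=
    Finset.filter_true_of_mem fun c _ => Unique.eq_default _
  rw [hfilter, Finset.card_univ, Fintype.card_coe, mul_comm]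
  congr 1
  rw [← Finset.prod_coe_sort T (fun c => P a c)]
  exact Finset.prod_congr rfl fun c _ => by rw [hg c]

/-- Row `{a, b}` (`a ≠ b`): `kerE w P {a,b} T = Σ_{d ⊆ T} w|d|·w|T∖d|·(∏_{c∈d} P a c)(∏_{c∈T∖d} P b c)`. -/
theorem kerE_pair (P : π → κ' → R) (a b : π) (hab : a ≠ b) (T : Finset κ') :
    kerE w P {a, b} T =
      ∑ d ∈ T.powerset, ((w d.card : ℕ) : R) * ((w (T \ d).card : ℕ) : R) *
        ((∏ c ∈ d, P a c) * ∏ c ∈ T \ d, P b c) := by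
  classical
  unfold kerE
  have ha : a ∈ ({a, b} : Finset π) := by simp
  have hb : b ∈ ({a, b} : Finset π) := by simp
  let dOf : (↥T → ↥({a, b} : Finset π)) → Finset κ' := fun g =>
    (Finset.univ.filter fun c : ↥T => ((g c : ↥({a, b} : Finset π)) : π) = a).map
      (Function.Embedding.subtype _)
  let gOf : Finset κ' → (↥T → ↥({a, b} : Finset π)) := fun d c =>
    if (c : κ') ∈ d then ⟨a, ha⟩ else ⟨b, hb⟩
  have mem_dOf : ∀ g (c : κ'), c ∈ dOf g ↔ ∃ hc : c ∈ T, ((g ⟨c, hc⟩ : π)) = a := by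
    intro g c
    simp only [dOf, Finset.mem_map, Finset.mem_filter, Finset.mem_univ, true_and,
      Function.Embedding.coe_subtype, Subtype.exists, exists_and_right, exists_eq_right]
  have dOf_sub : ∀ g, dOf g ⊆ T := fun g c hc => ((mem_dOf g c).mp hc).1
  have gval : ∀ (g : ↥T → ↥({a, b} : Finset π)) (c : ↥T),
      ((g c : π) = a ∧ (c : κ') ∈ dOf g) ∨ ((g c : π) = b ∧ (c : κ') ∉ dOf g) := by
    intro g c
    rcases Finset.mem_insert.mp (g c).2 with hga | hgb
    · exact Or.inl ⟨hga, (mem_dOf g c).mpr ⟨c.2, by simpa using hga⟩⟩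
    · rw [Finset.mem_singleton] at hgb
      refine Or.inr ⟨hgb, fun hc => ?_⟩
      obtain ⟨hc', e⟩ := (mem_dOf g c).mp hc
      exact hab (by rw [← hgb]; simpa using e.symm)
  refine Finset.sum_bij' (fun g _ => dOf g) (fun d _ => gOf d) ?_ ?_ ?_ ?_ ?_
  · exact fun g _ => Finset.mem_powerset.mpr (dOf_sub g)
  · exact fun d _ => Finset.mem_univ _
  · intro g _
    funext c
    rcases gval g c with ⟨hga, hcd⟩ | ⟨hgb, hcd⟩
    · exact Subtype.ext (by simp only [gOf, if_pos hcd]; exact hga.symm)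
    · exact Subtype.ext (by simp only [gOf, if_neg hcd]; exact hgb.symm)
  · intro d hd
    have hdT : d ⊆ T := Finset.mem_powerset.mp hd
    ext c
    rw [mem_dOf]
    constructor
    · rintro ⟨hc, e⟩
      by_contra hcd
      simp only [gOf, if_neg hcd] at e
      exact hab e.symm
    · intro hcd
      exact ⟨hdT hcd, by simp only [gOf, if_pos hcd]⟩
  · intro g _
    set d := dOf g with hd
    have hdT : d ⊆ T := dOf_sub g
    have hprod : (∏ c : ↥T, P (g c) c) = (∏ c ∈ d, P a c) * ∏ c ∈ T \ d, P b c := by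
      have e1 : (∏ c : ↥T, P (g c) c) = ∏ c : ↥T, (if (c : κ') ∈ d then P a c else P b c) := by
        refine Finset.prod_congr rfl fun c _ => ?_
        rcases gval g c with ⟨hga, hcd⟩ | ⟨hgb, hcd⟩
        · rw [if_pos hcd, hga]
        · rw [if_neg hcd, hgb]
      rw [e1, Finset.prod_coe_sort T (fun c => if c ∈ d then P a c else P b c), Finset.prod_ite,
        Finset.filter_mem_eq_inter, Finset.inter_eq_right.mpr hdT, Finset.filter_not,
        Finset.filter_mem_eq_inter, Finset.inter_eq_right.mpr hdT]
    have hfa : (Finset.univ.filter fun c : ↥T => ((g c : ↥({a, b} : Finset π)) : π) = a).card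
        = d.card := by
      rw [hd]
      simp only [dOf, Finset.card_map]
    have hfb : (Finset.univ.filter fun c : ↥T => ((g c : ↥({a, b} : Finset π)) : π) = b).card
        = (T \ d).card := by
      have e1 : (Finset.univ.filter fun c : ↥T => ((g c : ↥({a, b} : Finset π)) : π) = b) =
          Finset.univ.filter fun c : ↥T => ¬ (((g c : ↥({a, b} : Finset π)) : π) = a) := by
        ext c
        simp only [Finset.mem_filter, Finset.mem_univ, true_and]
        rcases gval g c with ⟨hga, _⟩ | ⟨hgb, _⟩
        · rw [hga]
          exact ⟨fun e => absurd e hab, fun ne => absurd rfl ne⟩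
        · rw [hgb]
          exact ⟨fun _ => fun e => hab e.symm, fun _ => rfl⟩
      rw [e1, Finset.filter_not, Finset.card_sdiff_of_subset (Finset.filter_subset _ _), hfa,
        Finset.card_univ, Fintype.card_coe, Finset.card_sdiff_of_subset hdT]
    have hw : (∏ a' : ↥({a, b} : Finset π),
        ((w (Finset.univ.filter fun c : ↥T => g c = a').card : ℕ) : R)) =
        ((w d.card : ℕ) : R) * ((w (T \ d).card : ℕ) : R) := by
      have e : ∀ a' : ↥({a, b} : Finset π), (Finset.univ.filter fun c : ↥T => g c = a') =
          Finset.univ.filter fun c : ↥T => ((g c : ↥({a, b} : Finset π)) : π) = (a' : π) :=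
        fun a' => by
          ext c
          simp only [Finset.mem_filter, Finset.mem_univ, true_and]
          exact ⟨fun e => by rw [e], fun e => Subtype.ext e⟩
      simp_rw [e]
      rw [Finset.prod_coe_sort ({a, b} : Finset π) (fun x : π =>
        ((w (Finset.univ.filter fun c : ↥T => ((g c : ↥({a, b} : Finset π)) : π) = x).card : ℕ)
          : R)), Finset.prod_pair hab, hfa, hfb]
    rw [hprod, hw]
    ring

/-- With unit weights the kernel entry is the midpoint entry `∏_{c∈T} Σ_{a∈S} P_{a,c}`. -/
theorem kerE_one (P : π → κ' → R) (S : Finset π) (T : Finset κ') :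
    kerE (fun _ => 1) P S T = ∏ c ∈ T, ∑ a ∈ S, P a c := by
  classical
  unfold kerE
  simp only [Nat.cast_one, Finset.prod_const_one, mul_one]
  rw [← Finset.prod_coe_sort T]
  simp_rw [← Finset.sum_coe_sort S]
  rw [Fintype.prod_sum]

end KerE

/-! ## 9. Kernel poisedness from THEOREM A^κ -/

section KernelPoised
variable (w : ℕ → ℕ) {h : ℕ}

/-- Row `∅` of the symbolic kernel matrix is the monomial row `e_0`. -/
theorem kerE_empty_eq_krow {r : ℕ} (hr : r ≤ 2 ^ h) (j : Fin r) :
    kerE w (fun (a : Fin h) (c : Fin h) => (MvPolynomial.X a : MvPolynomial (Fin h) ℂ) ^ 2 ^ (c : ℕ)) ∅ (benchCols h r j) =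
      krow w r (nodeY h) (Sum.inl 0) j := by
  have hj : (j : ℕ) < 2 ^ h := lt_of_lt_of_le j.2 hr
  rw [kerE_empty]
  simp only [krow]
  exact if_congr (benchCols_eq_empty_iff j hj) rfl rfl

/-- Row `{b}` of the symbolic kernel matrix is the attached row `(T_0, {b})`. -/
theorem kerE_singleton_eq_krow {r : ℕ} (hr : r ≤ 2 ^ h) (b : Fin h) (j : Fin r) :
    kerE w (fun (a : Fin h) (c : Fin h) => (MvPolynomial.X a : MvPolynomial (Fin h) ℂ) ^ 2 ^ (c : ℕ)) {b} (benchCols h r j) =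
      krow w r (nodeY h) (Sum.inr (Sum.inl (0, (b : ℕ)))) j := by
  have hj : (j : ℕ) < 2 ^ h := lt_of_lt_of_le j.2 hr
  rw [kerE_singleton]
  simp only [krow, bits_zero, Finset.empty_subset, if_true, Finset.sdiff_empty, Finset.card_empty,
    Nat.sub_zero]
  rw [prod_nodeY_pow, map_benchCols j hj, card_benchCols j hj]

/-- Row `{b, b'}` (`b ≠ b'`) of the symbolic kernel matrix is the pair row `(∅, {b, b'})`. -/
theorem kerE_pair_eq_krow {r : ℕ} (hr : r ≤ 2 ^ h) (b b' : Fin h) (hbb : b ≠ b') (j : Fin r) :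
    kerE w (fun (a : Fin h) (c : Fin h) => (MvPolynomial.X a : MvPolynomial (Fin h) ℂ) ^ 2 ^ (c : ℕ)) {b, b'}
        (benchCols h r j) =
      krow w r (nodeY h) (Sum.inr (Sum.inr ((b : ℕ), (b' : ℕ)))) j := by
  classical
  have hj : (j : ℕ) < 2 ^ h := lt_of_lt_of_le j.2 hr
  rw [Finset.pair_comm, kerE_pair w _ b' b (Ne.symm hbb)]
  simp only [krow]
  set T := benchCols h r j with hT
  have hbitsT : bits (j : ℕ) = T.map Fin.valEmbedding := (map_benchCols j hj).symm
  rw [hbitsT]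
  have himage : (T.map Fin.valEmbedding).powerset =
      T.powerset.image fun d => d.map Fin.valEmbedding := by
    rw [Finset.map_eq_image, Finset.powerset_image]
    congr 1
    funext d
    rw [Finset.map_eq_image]
  rw [himage, Finset.sum_image (fun d _ d' _ e => Finset.map_injective _ e)]
  refine Finset.sum_congr rfl fun d _ => ?_
  rw [← Finset.map_sdiff, Finset.card_map, Finset.card_map, prod_nodeY_pow, prod_nodeY_pow]
  ring

/-- **Reduction.**  If the stage-1 `w`-rows with symbolic Moore nodes are linearly independent, then
`KernelPoisedAt w h`. -/
theorem kernelPoisedAt_of_linearIndependent (h : ℕ)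
    (hLI : LinearIndependent (MvPolynomial (Fin h) ℂ)
      (fun x : ↥(stageRows 1 h) => krow w (windowStart (h + 1)) (nodeY h) (x : RowLabel))) :
    KernelPoisedAt w h := by
  classical
  intro r u hu hcard hsurj
  have hr : r = windowStart (h + 1) := by
    have himg : Finset.univ.image u =
        (Finset.univ : Finset (Finset (Fin h))).filter fun S => S.card ≤ 2 := by
      ext S
      simp only [Finset.mem_image, Finset.mem_univ, true_and, Finset.mem_filter]
      constructor
      · rintro ⟨i, rfl⟩
        exact hcard i
      · intro hS
        obtain ⟨i, hi⟩ := hsurj S hS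
        exact ⟨i, hi⟩
    have := congrArg Finset.card himg
    rwa [Finset.card_image_of_injective _ hu, Finset.card_univ, Fintype.card_fin,
      card_filter_card_le_two] at this
  subst hr
  have hr2 : windowStart (h + 1) ≤ 2 ^ h := windowStart_succ_le_two_pow h
  obtain ⟨lab, lab_empty, lab_single, lab_pair⟩ : ∃ lab : Finset (Fin h) → RowLabel,
      lab ∅ = Sum.inl 0 ∧ (∀ b : Fin h, lab {b} = Sum.inr (Sum.inl (0, (b : ℕ)))) ∧
      (∀ b b' : Fin h, b < b' → lab {b, b'} = Sum.inr (Sum.inr ((b : ℕ), (b' : ℕ)))) := by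
    refine ⟨fun S => if hS : S.Nonempty then
      (if S.card = 1 then Sum.inr (Sum.inl (0, ((S.min' hS : Fin h) : ℕ)))
       else Sum.inr (Sum.inr (((S.min' hS : Fin h) : ℕ), ((S.max' hS : Fin h) : ℕ))))
      else Sum.inl 0, by simp, fun b => by simp, fun b b' hlt => ?_⟩
    have hne : ({b, b'} : Finset (Fin h)).Nonempty := ⟨b, by simp⟩
    have hc : ({b, b'} : Finset (Fin h)).card ≠ 1 := by
      rw [Finset.card_pair (ne_of_lt hlt)]
      norm_num
    have hmin : ({b, b'} : Finset (Fin h)).min' hne = b :=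
      le_antisymm (Finset.min'_le _ _ (by simp))
        (Finset.le_min' _ _ _ fun y hy => by
          rcases Finset.mem_insert.mp hy with rfl | hy
          · exact le_rfl
          · rw [Finset.mem_singleton.mp hy]; exact le_of_lt hlt)
    have hmax : ({b, b'} : Finset (Fin h)).max' hne = b' :=
      le_antisymm
        (Finset.max'_le _ _ _ fun y hy => by
          rcases Finset.mem_insert.mp hy with rfl | hy
          · exact le_of_lt hlt
          · rw [Finset.mem_singleton.mp hy])
        (Finset.le_max' _ _ (by simp))
    simp only [hne, dif_pos, hc, if_false, hmin, hmax]
  have hrow : ∀ i j, kerE w (fun (a : Fin h) (c : Fin h) => (MvPolynomial.X a : MvPolynomial (Fin h) ℂ) ^ 2 ^ (c : ℕ))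
      (u i) (benchCols h (windowStart (h + 1)) j) =
      krow w (windowStart (h + 1)) (nodeY h) (lab (u i)) j := by
    intro i j
    rcases eq_empty_or_singleton_or_pair (u i) (hcard i) with h0 | ⟨b, hb⟩ | ⟨b, b', hlt, hbb⟩
    · rw [h0, lab_empty]
      exact kerE_empty_eq_krow w hr2 j
    · rw [hb, lab_single]
      exact kerE_singleton_eq_krow w hr2 b j
    · rw [hbb, lab_pair b b' hlt]
      exact kerE_pair_eq_krow w hr2 b b' (ne_of_lt hlt) j
  have hmem : ∀ i, lab (u i) ∈ stageRows 1 h := by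
    intro i
    rcases eq_empty_or_singleton_or_pair (u i) (hcard i) with h0 | ⟨b, hb⟩ | ⟨b, b', hlt, hbb⟩
    · rw [h0, lab_empty, inl_mem_stageRows, windowStart_one]
      exact Nat.one_pos
    · rw [hb, lab_single, inr_inl_mem_stageRows]
      exact ⟨Nat.one_pos, b.2⟩
    · rw [hbb, lab_pair b b' hlt, inr_inr_mem_stageRows]
      exact ⟨hlt, b'.2⟩
  have hinj : Function.Injective fun i => (⟨lab (u i), hmem i⟩ : ↥(stageRows 1 h)) := by
    intro i i' e
    have e' : lab (u i) = lab (u i') := congrArg Subtype.val e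
    apply hu
    rcases eq_empty_or_singleton_or_pair (u i) (hcard i) with h0 | ⟨b, hb⟩ | ⟨b, b', hlt, hbb⟩ <;>
      rcases eq_empty_or_singleton_or_pair (u i') (hcard i') with h0' | ⟨c, hc⟩ | ⟨c, c', hlt', hcc⟩
    · rw [h0, h0']
    · rw [h0, lab_empty, hc, lab_single] at e'
      exact absurd e' (by simp)
    · rw [h0, lab_empty, hcc, lab_pair c c' hlt'] at e'
      exact absurd e' (by simp)
    · rw [hb, lab_single, h0', lab_empty] at e'
      exact absurd e' (by simp)
    · rw [hb, lab_single, hc, lab_single] at e'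
      rw [hb, hc]
      simp only [Sum.inr.injEq, Sum.inl.injEq, Prod.mk.injEq, true_and] at e'
      rw [Fin.ext e']
    · rw [hb, lab_single, hcc, lab_pair c c' hlt'] at e'
      exact absurd e' (by simp)
    · rw [hbb, lab_pair b b' hlt, h0', lab_empty] at e'
      exact absurd e' (by simp)
    · rw [hbb, lab_pair b b' hlt, hc, lab_single] at e'
      exact absurd e' (by simp)
    · rw [hbb, lab_pair b b' hlt, hcc, lab_pair c c' hlt'] at e'
      rw [hbb, hcc]
      simp only [Sum.inr.injEq, Prod.mk.injEq] at e'
      rw [Fin.ext e'.1, Fin.ext e'.2]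
  have hLI' : LinearIndependent (MvPolynomial (Fin h) ℂ)
      (fun i => krow w (windowStart (h + 1)) (nodeY h) (lab (u i))) :=
    hLI.comp (fun i => (⟨lab (u i), hmem i⟩ : ↥(stageRows 1 h))) hinj
  set B : Matrix (Fin (windowStart (h + 1))) (Fin (windowStart (h + 1))) (MvPolynomial (Fin h) ℂ) :=
    Matrix.of fun i j => kerE w (fun (a : Fin h) (c : Fin h) => (MvPolynomial.X a : MvPolynomial (Fin h) ℂ) ^ 2 ^ (c : ℕ))
      (u i) (benchCols h (windowStart (h + 1)) j) with hB
  have hBrows : LinearIndependent (MvPolynomial (Fin h) ℂ) (fun i => B i) := by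
    have e : (fun i => B i) = fun i => krow w (windowStart (h + 1)) (nodeY h) (lab (u i)) := by
      funext i j
      rw [hB, Matrix.of_apply, hrow]
    rw [e]
    exact hLI'
  have hBdet : B.det ≠ 0 := det_ne_zero_of_linearIndependent_rows' B hBrows
  obtain ⟨Y, hY⟩ : ∃ Y : Fin h → ℂ, MvPolynomial.eval Y B.det ≠ 0 := by
    by_contra hall
    push Not at hall
    exact hBdet (MvPolynomial.funext fun Y => by rw [hall Y, map_zero])
  refine ⟨fun a c => Y a ^ 2 ^ (c : ℕ), ?_⟩
  rw [RingHom.map_det] at hY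
  have hmat : (MvPolynomial.eval Y).mapMatrix B = Matrix.of fun i j : Fin (windowStart (h + 1)) =>
      kerE w (fun (a : Fin h) (c : Fin h) => Y a ^ 2 ^ (c : ℕ)) (u i) (benchCols h (windowStart (h + 1)) j) := by
    ext i j
    rw [RingHom.mapMatrix_apply, Matrix.map_apply, hB, Matrix.of_apply, Matrix.of_apply, map_kerE]
    congr 1
    funext a c
    rw [map_pow, MvPolynomial.eval_X]
  rw [hmat] at hY
  exact hY

/-- **Kernel poisedness from THEOREM A^κ**: if `w` has no zero and `det G^w_i ≠ 0` for `1 ≤ i ≤ h`, then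
`KernelPoisedAt w h`. -/
theorem kernelPoisedAt_of_kpeel (hw : ∀ k, w k ≠ 0) (h : ℕ)
    (hdet : ∀ i : ℕ, 1 ≤ i → i ≤ h → (kpeelMatrix w i).det ≠ 0) : KernelPoisedAt w h :=
  kernelPoisedAt_of_linearIndependent w h (linearIndependent_krow_stageOne w hw h hdet)

end KernelPoised

/-- `KernelPoisedAt 1 h` is `MidpointPoisedAt h` (THEOREM M in the kernel-entry language). -/
theorem kernelPoisedAt_one_iff (h : ℕ) : KernelPoisedAt (fun _ => 1) h ↔ MidpointPoisedAt h := by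
  simp only [KernelPoisedAt, MidpointPoisedAt, kerE_one]

/-- THEOREM M again: `KernelPoisedAt 1 h` for every `h`. -/
theorem kernelPoisedAt_one (h : ℕ) : KernelPoisedAt (fun _ => 1) h :=
  (kernelPoisedAt_one_iff h).mpr (midpointPoisedAt h)
/-- With factorial weights: `KernelPoisedAt Nat.factorial h` — which is the line file's
`SegmentMeanValueAt h` verbatim — holds whenever `det G_1, …, det G_h ≠ 0` (`G_i = peelMatrix i`, certified in
the tree for `i ≤ 52`, `…MooreBenchCert*`; `det G_183 = 0`). -/
theorem kernelPoisedAt_factorial_of_peel (h : ℕ)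
    (hdet : ∀ i : ℕ, 1 ≤ i → i ≤ h → (peelMatrix i).det ≠ 0) : KernelPoisedAt Nat.factorial h :=
  kernelPoisedAt_of_kpeel Nat.factorial (fun k => Nat.factorial_ne_zero k) h
    (fun i hi hih => by rw [kpeelMatrix_factorial]; exact hdet i hi hih)

end Summit.ValiantsHypothesis.ValiantsHypothesis.Theorems.BarrierLever.MoorePeel
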